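import Summits.CriticalPhenomena.CardyFormulaZ2.Theorems.CardySelfRefinementSymmetryUpgradeRReflectionLattice
import Literature.Probability.RandomPlanarGeometry.FreelyJointedSAWCovariance
import Literature.Probability.Percolation.LoopRotationInvarianceAssembly
import Literature.Probability.Percolation.CylinderLoops
import HarnessLib

/-!
# The reflected exploration path runs backwards; the reflected interface class is the conjugate
(helper for stub `stub_reflectionCovariant`, line `SketchIdeatorTwo`, crux `SymmetryUpgradeR`,
stmt-CriticalPhenomena-17239; registered helper stub `stub_reflectionCovariant_interface`)

Second helper file of the ACHIRALITY stub (Werner 2007 §3.2 (3)), on top of the lattice dictionary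
`…SymmetryUpgradeRReflectionLattice`.  For square-lattice Dobrushin data `E`, `E'` reflected into
each other (`E'.Ω = conj E.Ω`, `E'.δ = E.δ`, `E'.arcA = conj E.arcA`, `E'.arcB = conj E.arcB`):

* `isMedialExploration_reflect` — if `γ` is G02's medial exploration path of `ω` in admissible
  `E` (arc `A` on the LEFT), then the reflected list TRAVERSED BACKWARDS,
  `γ.reverse.map (Sym2.map cellReflect)`, is an exploration path of the reflected configuration
  in `E'`: steps and turns are reversed by the reflection, the two `A`–`B` edges are exchanged,
  and the first dart of the reversed path — the reflected LAST dart of `γ` — has an arc-`A` vertex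
  on its left (`exists_last_corner_mem_zdArcA`: the left-vertex invariant `cornerOrbit_inv` along
  the orbit from the start corner and the exit analysis of `MedialInterfaceProofs.lean`);
  by uniqueness (`existsUnique_medialExploration_holds`) `medialExploration_reflect` (= the
  registered helper stub `stub_reflectionCovariant_interface`);
* medial midpoints are conjugated (`medialPoint_reflect`), dyadic polylines are equivariant under
  the real-affine map `conj` (`Polyline.polyline_map_apply`) and reversing the vertex list reverses
  the polyline modulo reparametrisation (`reparamDist_polyline_reverse`), so the exploration
  polyline of `E'` is the conjugate polyline of `E` run backwards (`medialExplorationCurve_reflect`,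
  `mk_polyline_map_conj_reverse`, `mk_reverse_polyline_map_conj_reverse`);
* `bondInterfaceIn_reflect` — EXACT LATTICE IDENTITY: whenever the two ends of the exploration
  polyline of `E` lie near different marks of `(D; a, b)`, the endpoint rule `orientCurve`
  re-orients the reversed reflected path, and the interface class of the reflected configuration
  in `E'`, in the conjugate domain `(D̄; ā, b̄) = D.map conj`, is `conj_*` of the interface class.

References: W. Werner, *Lectures on two-dimensional critical percolation* (2007), §3.2;
S. Smirnov, C. R. Acad. Sci. Paris 333 (2001), §2; M. Aizenman, A. Burchard, Duke Math. J. 99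
(1999), §2.1 (curves modulo reparametrisation).
-/

noncomputable section

namespace Summit.CriticalPhenomena.CardyFormulaZ2.Theorems.SymmetryUpgradeR.SwallowingSkeleton

open MeasureTheory Filter Set
open Literature.Probability.RandomPlanarGeometry Literature.Probability.LatticeModels
  Literature.Probability.Percolation
open UpperHalfPlane (upperHalfPlaneSet)

/-! ### List bookkeeping for reversed paths -/

/-- The darts of a reversed list are the reversed, swapped darts of the list. -/
theorem zip_tail_reverse_eq {α : Type*} (l : List α) :
    l.reverse.zip l.reverse.tail = ((l.zip l.tail).map Prod.swap).reverse := by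
  apply List.ext_getElem
  · simp only [List.length_zip, List.length_reverse, List.length_tail, List.length_map]
  · intro i h₁ h₂
    simp only [List.length_zip, List.length_reverse, List.length_tail] at h₁
    simp only [List.getElem_zip, List.getElem_reverse, List.getElem_tail, List.getElem_map,
      List.length_zip, List.length_tail, List.length_map, Prod.swap_prod_mk, Prod.mk.injEq]
    exact ⟨getElem_congr_idx (by omega), getElem_congr_idx (by omega)⟩

/-! ### The last dart of an exploration path -/

/-- **The last dart of an exploration path has its vertex on the arc `A`** (left-vertex invariant
along the orbit from the start corner, `cornerOrbit_inv`, and the exit analysis: the last edge is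
an `A`–`B` edge, so the vertex lies on the arcs, hence on `A`). Stated for the reversed list. -/
theorem exists_last_corner_mem_zdArcA {D : DiscreteDobrushin} (hD : D.IsZdAdmissible)
    {ω : BondConfig (Site 2)} {γ : List MedialVertex} (hγ : IsMedialExploration D ω γ)
    (h1 : 1 < γ.reverse.length) :
    ∃ v f, IsCorner v f ∧ cornerSource v f = γ.reverse[1] ∧ cornerTarget v f = γ.reverse[0] ∧
      v ∈ D.zdArcA := by
  classical
  obtain ⟨c₀, hc₀, -⟩ := DiscreteDobrushin.existsUnique_startCorner hD
  have hc₀' : D.IsStartCorner c₀ := ⟨hc₀.1, hc₀.2.1, hc₀.2.2⟩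
  obtain ⟨m, hm⟩ : ∃ m, γ.length = m + 2 :=
    ⟨γ.length - 2, by have := hγ.one_lt_length; omega⟩
  obtain ⟨-, hsrc, htgt⟩ := hγ.dart_eq hD hc₀' m (by omega)
  set p := cornerOrbit (D.bcBondConfig ω) c₀ m with hp
  refine ⟨p.1, cFace p, isCorner_cFace p, ?_, ?_, ?_⟩
  · rw [cornerSource_cFace, hsrc, List.getElem_reverse]
    exact getElem_congr_idx (by omega)
  · rw [cornerTarget_cFace, htgt, List.getElem_reverse]
    exact getElem_congr_idx (by omega)
  · have hlast : cTgt p ∈ D.zdABEdges := by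
      have := hγ.getLast_mem
      rw [List.getLast_eq_getElem] at this
      rw [htgt]
      convert this using 2
      omega
    obtain ⟨x, k, hxA, hkB, heq, -⟩ := DiscreteDobrushin.exists_out_or_in_of_mem_zdABEdges hD hlast
    have hv : p.1 ∈ cTgt p := Sym2.mem_mk_left _ _
    rw [heq] at hv
    refine DiscreteDobrushin.mem_zdArcA_of_inv hD (cornerOrbit_inv hc₀' m) ?_
    rcases Sym2.mem_iff.1 hv with h | h
    · exact Or.inl (h ▸ hxA)
    · exact Or.inr (h ▸ hkB)

/-! ### The exploration path of the reflected data is the reversed reflected path -/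

section Reverse

variable {E E' : DiscreteDobrushin}
  (hΩ : E'.Ω = (starRingEnd ℂ) '' E.Ω) (hδ : E'.δ = E.δ)
  (hA : E'.arcA = (starRingEnd ℂ) '' E.arcA)
  (hB : E'.arcB = (starRingEnd ℂ) '' E.arcB)
include hΩ hδ hA hB

/-- **Transport of structure.** The reflected exploration path of `ω` in admissible data `E`,
TRAVERSED BACKWARDS, is an exploration path of the reflected configuration in the reflected data:
steps and turns are reversed by the reflection (`isMedialStep_reflect_iff`,
`isMedialTurn_reflect_iff`), the two `A`–`B` edges are exchanged, and the first dart of the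
reversed path — the reflected last dart — has an arc-`A` vertex on its left
(`exists_last_corner_mem_zdArcA`). -/
theorem isMedialExploration_reflect (hE : E.IsZdAdmissible) {ω : BondConfig (Site 2)}
    {γ : List MedialVertex} (h : IsMedialExploration E ω γ) :
    IsMedialExploration E' (BondConfig.relabel (sym2Equiv cellReflect) ω)
      (γ.reverse.map (sym2Equiv cellReflect)) := by
  have hback : ∀ l : List MedialVertex,
      (l.map (sym2Equiv cellReflect)).map (sym2Equiv cellReflect).symm = l := fun l => by
    rw [List.map_map, Equiv.symm_comp_self, List.map_id]
  have hne : γ.reverse.map (sym2Equiv cellReflect) ≠ [] := by simpa using h.ne_nil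
  refine ⟨hne, ?_, ?_, ?_, ?_, ?_, ?_, ?_⟩
  · intro e e' hinf
    have h2 := hinf.map (sym2Equiv cellReflect).symm
    rw [hback] at h2
    have h3 : [(sym2Equiv cellReflect).symm e', (sym2Equiv cellReflect).symm e] <:+: γ := by
      simpa using List.reverse_infix.2 h2
    have := (isMedialStep_reflect_iff hΩ hδ _ _).2 (h.step _ _ h3)
    simpa only [Equiv.apply_symm_apply] using this
  · intro e₀ e₁ e₂ hinf
    have h2 := hinf.map (sym2Equiv cellReflect).symm
    rw [hback] at h2
    have h3 : [(sym2Equiv cellReflect).symm e₂, (sym2Equiv cellReflect).symm e₁,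
        (sym2Equiv cellReflect).symm e₀] <:+: γ := by
      simpa using List.reverse_infix.2 h2
    have := (isMedialTurn_reflect_iff (E.bcBondConfig ω) _ _ _).2 (h.turn _ _ _ h3)
    rw [← bcBondConfig_reflect hΩ hδ hA hB] at this
    simpa only [Equiv.apply_symm_apply] using this
  · rw [← List.map_tail, List.zip_map, zip_tail_reverse_eq]
    exact (List.nodup_reverse.2 (h.nodup.map Prod.swap_injective)).map
      ((sym2Equiv _).injective.prodMap (sym2Equiv _).injective)
  · rw [List.head_map, List.head_reverse]
    exact (reflect_mem_zdABEdges_iff hΩ hδ hA hB _).2 h.getLast_mem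
  · rw [List.getLast_map, List.getLast_reverse]
    exact (reflect_mem_zdABEdges_iff hΩ hδ hA hB _).2 h.head_mem
  · rw [List.head_map, List.getLast_map, List.head_reverse, List.getLast_reverse]
    exact fun heq => h.head_ne_getLast ((sym2Equiv _).injective heq).symm
  · intro e e' hpre
    obtain ⟨hl, rfl, rfl⟩ := getElem_of_prefix_pair hpre
    have hl' : 1 < γ.reverse.length := by simpa using hl
    obtain ⟨v, f, hc, hs, ht, hvA⟩ := exists_last_corner_mem_zdArcA hE h hl'
    refine ⟨cellReflect v, CellSymmetry.reflect.face f, (isCorner_reflect_iff v f).2 hc, ?_, ?_,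
      (mem_zdArcA_reflect_iff hΩ hδ hA v).2 hvA⟩
    · rw [cornerSource_reflect hc, ht, List.getElem_map]
    · rw [cornerTarget_reflect hc, hs, List.getElem_map]

/-- **Reflection covariance of the medial exploration path**: for admissible data, exploring the
reflected data in the reflected configuration gives the reflected path traversed backwards (both
data are admissible, so both explorations are THE unique ones,
`existsUnique_medialExploration_holds`). -/
theorem medialExploration_reflect (hE : E.IsZdAdmissible) (ω : BondConfig (Site 2)) :
    medialExploration E' (BondConfig.relabel (sym2Equiv cellReflect) ω) =
      (medialExploration E ω).reverse.map (sym2Equiv cellReflect) := by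
  have hE' := stub_reflectionCovariant_lattice E E' hΩ hδ hA hB hE
  obtain ⟨γ', -, huniq⟩ :=
    existsUnique_medialExploration_holds E' hE' (BondConfig.relabel (sym2Equiv cellReflect) ω)
  rw [huniq _ (isMedialExploration_medialExploration_holds E' hE' _), huniq _
    (isMedialExploration_reflect hΩ hδ hA hB hE (isMedialExploration_medialExploration_holds E hE ω))]

end Reverse

/-! ### Medial midpoints, polylines and curve classes under `z ↦ z̄` -/

/-- Mesh points are transported by the reflection: `δ σx = conj (δ x)`. -/
theorem meshPoint_cellReflect (δ : ℝ) (x : Site 2) :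
    meshPoint δ (cellReflect x) = (starRingEnd ℂ) (meshPoint δ x) := by
  rw [← CellSymmetry.reflect_plane_apply]
  exact CellSymmetry.reflect.meshPoint_cell δ x


/-- The medial midpoint of a reflected medial vertex is the conjugate midpoint. -/
theorem medialPoint_reflect (δ : ℝ) (e : MedialVertex) :
    medialPoint δ (sym2Equiv cellReflect e) = (starRingEnd ℂ) (medialPoint δ e) := by
  induction e using Sym2.ind with
  | h x y =>
    rw [sym2Equiv_mk, medialPoint_mk, medialPoint_mk, meshPoint_cellReflect, meshPoint_cellReflect,
      map_div₀, map_add, map_ofNat]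

/-- Polylines are equivariant under complex conjugation (a real-affine map). -/
theorem polyline_map_conj_apply (a : ℂ) (l : List ℂ) (t : unitInterval) :
    polyline ((a :: l).map (starRingEnd ℂ)) t = (starRingEnd ℂ) (polyline (a :: l) t) := by
  have hcoe : (⇑(Complex.conjLIE.toLinearEquiv.toLinearMap.toAffineMap) : ℂ → ℂ) = starRingEnd ℂ := by
    funext z
    simp
  have h := Polyline.polyline_map_apply (Complex.conjLIE.toLinearEquiv.toLinearMap.toAffineMap) a l t
  rwa [hcoe] at h

/-- Conjugation as a continuous map acts as `conj`. -/
@[simp] theorem conjHomeomorph_continuousMap_apply (z : ℂ) :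
    (Complex.conjLIE.toHomeomorph : C(ℂ, ℂ)) z = (starRingEnd ℂ) z := by
  simp

/-- **The reversed conjugate polyline is the conjugate of the reversed polyline** (as curve
classes: the dyadic polyline through the reversed list is a reparametrisation of the time
reversal, `reparamDist_polyline_reverse`). -/
theorem mk_polyline_map_conj_reverse {L : List ℂ} (hL : L ≠ []) :
    CurveClass.mk (⟨polyline (L.map (starRingEnd ℂ)).reverse⟩ : Curve ℂ) =
      (CurveClass.mk (⟨reverseCurve (polyline L)⟩ : Curve ℂ)).map
        (Complex.conjLIE.toHomeomorph : C(ℂ, ℂ)) := by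
  obtain ⟨a, l, rfl⟩ := List.exists_cons_of_ne_nil hL
  rw [CurveClass.mk_eq_mk.2 (reparamDist_polyline_reverse _), CurveClass.map_mk]
  congr 1
  refine Curve.ext (ContinuousMap.ext fun t => ?_)
  simp only [ContinuousMap.comp_apply, ContinuousMap.coe_mk]
  rw [polyline_map_conj_apply]
  rfl

/-- **The time reversal of the reversed conjugate polyline is the conjugate polyline** (as curve
classes). -/
theorem mk_reverse_polyline_map_conj_reverse {L : List ℂ} (hL : L ≠ []) :
    CurveClass.mk (⟨reverseCurve (polyline (L.map (starRingEnd ℂ)).reverse)⟩ : Curve ℂ) =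
      (CurveClass.mk (⟨polyline L⟩ : Curve ℂ)).map (Complex.conjLIE.toHomeomorph : C(ℂ, ℂ)) := by
  obtain ⟨a, l, rfl⟩ := List.exists_cons_of_ne_nil hL
  have h := reparamDist_polyline_reverse ((a :: l).map (starRingEnd ℂ)).reverse
  rw [List.reverse_reverse] at h
  have h' : CurveClass.mk (⟨reverseCurve (polyline ((a :: l).map (starRingEnd ℂ)).reverse)⟩ : Curve ℂ) =
      CurveClass.mk (⟨polyline ((a :: l).map (starRingEnd ℂ))⟩ : Curve ℂ) :=
    (CurveClass.mk_eq_mk.2 h).symm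
  rw [h', CurveClass.map_mk]
  congr 1
  refine Curve.ext (ContinuousMap.ext fun t => ?_)
  change polyline ((a :: l).map (starRingEnd ℂ)) t = _
  rw [polyline_map_conj_apply]
  rfl


/-! ### The interface class of the reflected data -/

section Interface

variable {E E' : DiscreteDobrushin}
  (hΩ : E'.Ω = (starRingEnd ℂ) '' E.Ω) (hδ : E'.δ = E.δ)
  (hA : E'.arcA = (starRingEnd ℂ) '' E.arcA)
  (hB : E'.arcB = (starRingEnd ℂ) '' E.arcB)
include hΩ hδ hA hB

/-- The medial midpoints of the exploration of the reflected data: the conjugates of those of the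
data, in reverse order. -/
theorem medialExploration_map_medialPoint_reflect (hE : E.IsZdAdmissible)
    (ω : BondConfig (Site 2)) :
    (medialExploration E' (BondConfig.relabel (sym2Equiv cellReflect) ω)).map (medialPoint E'.δ) =
      (((medialExploration E ω).map (medialPoint E.δ)).map (starRingEnd ℂ)).reverse := by
  rw [medialExploration_reflect hΩ hδ hA hB hE, hδ, List.map_map, List.map_map, List.map_reverse]
  congr 2
  funext e
  exact medialPoint_reflect E.δ e

/-- The exploration polyline of the reflected data is the polyline through the conjugate medial
midpoints in reverse order. -/
theorem medialExplorationCurve_reflect (hE : E.IsZdAdmissible) (ω : BondConfig (Site 2)) :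
    medialExplorationCurve E' (BondConfig.relabel (sym2Equiv cellReflect) ω) =
      polyline (((medialExploration E ω).map (medialPoint E.δ)).map (starRingEnd ℂ)).reverse := by
  rw [medialExplorationCurve, medialExploration_map_medialPoint_reflect hΩ hδ hA hB hE]

/-- **Exact reflection covariance of the interface class** (lattice level). If the exploration
polyline of admissible data `E` starts at least as close to `a` as to `b` and ends closer to `b`,
or starts closer to `b` and ends at least as close to `a`, then the interface of the reflected
configuration in the reflected data, in the conjugate Dobrushin domain `(D̄; ā, b̄)`, is the
conjugate of the interface: the endpoint rule `orientCurve` re-orients the reversed reflected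
path back. -/
theorem bondInterfaceIn_reflect (D : DobrushinDomain) (hE : E.IsZdAdmissible) (ω : BondConfig (Site 2))
    (hsep : (dist (medialExplorationCurve E ω 0) (D.pt 0) ≤ dist (medialExplorationCurve E ω 0) (D.pt 1) ∧
        dist (medialExplorationCurve E ω 1) (D.pt 1) < dist (medialExplorationCurve E ω 1) (D.pt 0)) ∨
      (dist (medialExplorationCurve E ω 0) (D.pt 1) < dist (medialExplorationCurve E ω 0) (D.pt 0) ∧
        dist (medialExplorationCurve E ω 1) (D.pt 0) ≤ dist (medialExplorationCurve E ω 1) (D.pt 1))) :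
    bondInterfaceIn (D.map Complex.conjLIE.toHomeomorph) E'
        (BondConfig.relabel (sym2Equiv cellReflect) ω) =
      (bondInterfaceIn D E ω).map (Complex.conjLIE.toHomeomorph : C(ℂ, ℂ)) := by
  have hc : medialExplorationCurve E ω = polyline ((medialExploration E ω).map (medialPoint E.δ)) := rfl
  have hc' := medialExplorationCurve_reflect hΩ hδ hA hB hE ω
  have hLne : (medialExploration E ω).map (medialPoint E.δ) ≠ [] := by
    simpa using (isMedialExploration_medialExploration_holds E hE ω).ne_nil
  rw [bondInterfaceIn_apply, bondInterfaceIn_apply, hc', hc]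
  rw [hc] at hsep
  generalize (medialExploration E ω).map (medialPoint E.δ) = L at hsep hLne ⊢
  have hL'ne : (L.map (starRingEnd ℂ)).reverse ≠ [] := by simpa using hLne
  -- the reflected polyline starts at the conjugate of the end of the polyline
  have h0' : polyline ((L.map (starRingEnd ℂ)).reverse) 0 = (starRingEnd ℂ) (polyline L 1) := by
    rw [polyline_apply_zero_of_ne_nil hL'ne, List.head_reverse, List.getLast_map,
      polyline_apply_one_of_ne_nil hLne]
  have hpt : ∀ i, (D.map Complex.conjLIE.toHomeomorph).pt i = (starRingEnd ℂ) (D.pt i) := fun i => by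
    simp [MarkedDomain.pt_map]
  rcases hsep with ⟨h0, h1⟩ | ⟨h0, h1⟩
  · rw [orientCurve_of_le D h0, orientCurve_of_lt _ ?_, mk_reverse_polyline_map_conj_reverse hLne]
    rwa [h0', hpt, hpt, Complex.dist_conj_conj, Complex.dist_conj_conj]
  · rw [orientCurve_of_lt D h0, orientCurve_of_le _ ?_, mk_polyline_map_conj_reverse hLne]
    rwa [h0', hpt, hpt, Complex.dist_conj_conj, Complex.dist_conj_conj]

end Interface

/-- **Registered helper stub `stub_reflectionCovariant_interface`** (tree vocabulary; =
`medialExploration_reflect`): for admissible data, G02's exploration path of the reflected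
configuration in the conjugate data is the reflected exploration path traversed backwards. -/
theorem stub_reflectionCovariant_interface : ∀ (E E' : DiscreteDobrushin), E'.Ω = (starRingEnd ℂ) '' E.Ω → E'.δ = E.δ → E'.arcA = (starRingEnd ℂ) '' E.arcA → E'.arcB = (starRingEnd ℂ) '' E.arcB → E.IsZdAdmissible → ∀ ω : BondConfig (Site 2), medialExploration E' (BondConfig.relabel (sym2Equiv cellReflect) ω) = ((medialExploration E ω).reverse).map (sym2Equiv cellReflect) :=
  fun _ _ hΩ hδ hA hB hE ω => medialExploration_reflect hΩ hδ hA hB hE ω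

end Summit.CriticalPhenomena.CardyFormulaZ2.Theorems.SymmetryUpgradeR.SwallowingSkeleton

end
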